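import Summits.ABC.StewartYu.ArchG3RecLinesHJ
import HarnessLib

/-!
# The archimedean record `ArchG3Rec` — letter lines in closed form, H family (half step): THE (J) AND (C) LINES, THE FAMILY

Support file (theorems only; no named facts). Cell `abc-stewartyu`, route `YuMatveevShapeRat`, crux r2 `ArchCoreRat` (stmt-ABC-20502),
line `arch-g3-frame`, seam (B) of `stub_recLinesArch`, plan R50: the jets line (J), the comparison line (C) and the smallness letter of
`HalfStepLinesK (2^(n−1)) c lev` — all three killed by the comparison constant `U0 c ≥ 2^{3n}·Z ≥ 128·(nB + B)` (p4's `U0_ge`,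
`c ≥ 2^63`; atoms in `ArchG3RecLinesHJ`) — and the assembled family **`halfStepLinesK_holds (hn : 2 ≤ n) (hmono : Monotone P.A)
(hlev : lev < Ŝ) (hc : 2^63 ≤ c) : P.HalfStepLinesK (2^(n−1)) c lev`** (side conditions = p1's `side_half`; (F) = `halfF_holds`).

## References
* [Nesterenko2003] Yu. V. Nesterenko, LNM 1819 (2003) — §4 Prop. 4.1, §4.3 (4.36)–(4.51); shape only.
-/

noncomputable section

open Finset Real
open scoped Nat
open Summit.ABC.StewartYu.ArchSupply (WC)
open Summit.ABC.StewartYu.ArchG3Setup (DΔC)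

namespace Summit.ABC.StewartYu

namespace ArchG3Rec

open PadicG3Par (Cb Cb_pos)
open ArchG3Par (G K yloadK G_eq G_pos K_pos yloadK_pos eight_le_G one_le_K)

variable {n : ℕ} (P : ArchG3Rec n)

/-! ### The smallness letter, the jets line (J) and the comparison line (C) -/

/-- **the smallness letter of the half step**: `LbRK·δR c·(3Nf+2) ≤ 1` for `c ≥ 2^63`. [cite: Nesterenko2003, §4.3 (4.50); shape only] -/
theorem halfSmall_holds (hn2 : 2 ≤ n) {lev : ℕ} (hlev : lev < P.Sd) {c : ℝ} (hc : (2 : ℝ) ^ 63 ≤ c) :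
    (P.LbRK (2 ^ (n - 1)) lev P.jl : ℝ) * P.δR c * (3 * P.Nf lev n + 2) ≤ 1 := by
  obtain ⟨-, hU⟩ := P.U0_big hn2 hc
  obtain ⟨h3, -, -⟩ := P.rho_succ_bounds lev
  exact P.small_prod_le hn2 hlev.le hU (by positivity) h3

/-- **the jets line (J) of the half step** of `HalfStepLinesK (2^(n−1)) c lev` (interpolation on `𝒳_{lev,n}` with `T lev` derivatives,
jets constant `CRK`, comparison on the radius `Nf`), for `n ≥ 2`, sorted weights, `lev < Ŝ`, `c ≥ 2^63`: killed by `U0 c ≥ 128(nB+B)`.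
[cite: Nesterenko2003, §4.3 (4.38)–(4.43); shape only] -/
theorem halfJ_holds (hn2 : 2 ≤ n) (hmono : Monotone P.A) {lev : ℕ} (hlev : lev < P.Sd) {c : ℝ} (hc : (2 : ℝ) ^ 63 ≤ c)
    (s : ℤ) (a : ℕ) (hsabs : |s| ≤ 2 * (P.Nh (lev + 1) : ℤ) - 1) (ha : a < P.Tf (lev + 1) 0) :
    P.γb lev * (3 * P.Nf lev n + 2) +
      Real.log (2 * ((2 * P.Nf lev n + 1 : ℕ) : ℝ) ^ (P.T lev + 1) * P.T lev * (20 * Real.exp 1) ^ ((2 * P.Nf lev n + 1) * P.T lev)) +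
      P.T lev * Real.log (2 * P.CRK (2 ^ (n - 1)) lev) + P.γb lev * (P.Nf lev n + 1) + a * Real.log 2 + P.T lev + P.cUR + P.cPRK (2 ^ (n - 1)) +
      Real.log (DΔC (P.YRK (2 ^ (n - 1)) lev) (P.Tf (lev + 1) 0)) + Real.log (WC P.H (P.Sd - (lev + 1) + 1) P.L₀ (P.Tf lev n) (P.Nf lev n)) +
      (P.γb lev + P.wl lev) * P.Nf lev n + P.cbRK (2 ^ (n - 1)) c lev (P.Nf lev n) +
      (2 : ℝ) ^ n * (Real.log 4 + (23 / 20 * a * P.H + (|(s : ℝ)| * ∑ j, ((P.LνRR lev j : ℝ) / P.N) * P.A j + n * P.SAR + 2 * P.SAR)) +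
        (Real.log 2 + P.cUR + P.cPRK (2 ^ (n - 1)) + Real.log (DΔC (P.YRK (2 ^ (n - 1)) lev) (P.Tf (lev + 1) 0)) +
          (Real.log (WC P.H (P.Sd - (lev + 1) + 1) P.L₀ (P.Tf (lev + 1) 0) (P.Nh (lev + 1))) + (P.γb lev + P.wl lev) * P.Nh (lev + 1) +
            P.AθsumR / 2)) + 2 * P.cHR) +
      Real.log 3 ≤ 0 := by
  have hκ : 1 ≤ 2 ^ (n - 1) := Nat.one_le_two_pow
  obtain ⟨-, -, hG, hL0, -, hT1, hT8⟩ := P.letters_real lev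
  have hX : (128 : ℝ) ≤ P.X := P.X_floors.2.1
  have hn : (2 : ℝ) ≤ n := by exact_mod_cast hn2
  have hn0 : (0 : ℝ) ≤ n := by linarith
  have h2n : (4 : ℝ) ≤ 2 ^ n :=
    calc (4 : ℝ) = 2 ^ 2 := by norm_num
      _ ≤ 2 ^ n := pow_le_pow_right₀ (by norm_num) hn2
  set XL : ℝ := (P.X : ℝ) * P.L with hXL
  have hXL0 : 0 < XL := by positivity
  have hZ : P.Z = 8 * ((n : ℝ) + 1) * XL := by unfold Z; rw [hG]
  -- `T lev ≤ 8L` ⇒ `σ = 35/4`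
  obtain ⟨hT', hT'0⟩ := P.Tsucc_le hn2 hlev hT8
  obtain ⟨-, tn, t1, tW, tN, tS, -⟩ := P.Tcost_le hT'0 (by norm_num) hT'
  -- the old order `Tf lev n ≤ Tf 0 0 ≤ (33/2)(n+1)L`
  have hTn : (P.Tf lev n : ℝ) ≤ 33 / 2 * (((n : ℝ) + 1) * P.L) := by
    have h1 : (P.Tf lev n : ℝ) ≤ P.Tf 0 0 := by exact_mod_cast P.Tf_le_Tf00 lev n
    have h2 := P.Tf00_le hn2
    linarith
  obtain ⟨-, -, -, -, -, tSn, -⟩ := P.Tcost_le (Nat.cast_nonneg (P.Tf lev n)) (by norm_num) hTn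
  -- the comparison constant
  obtain ⟨hU16, hU⟩ := P.U0_big hn2 hc
  -- radii, slab, unit count, print, Δ-weight, Hasse weights
  obtain ⟨-, -, hρNf, -, hNf0, -⟩ := P.rho_bounds lev
  obtain ⟨-, -, hNf1⟩ := P.rho_succ_bounds lev
  obtain ⟨hγ1, -, hwl3, hγ0, hwl0⟩ := P.gamma_le lev
  have hγ1b : P.γb lev * ((P.Nf lev n : ℝ) + 1) ≤ 31 / 40 * n * (2 ^ n * XL) + 2 ^ n * XL / 2 ^ 16 :=
    (mul_le_mul_of_nonneg_left (by linarith) hγ0).trans hγ1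
  have hγwNf : (P.γb lev + P.wl lev) * (P.Nf lev n : ℝ) ≤ (P.γb lev + P.wl lev) * (3 * (P.Nf lev n : ℝ) + 2) :=
    mul_le_mul_of_nonneg_left (by linarith) (by linarith)
  obtain ⟨hcU, -⟩ := P.cUR_le' hn2
  have hcP := P.cPRK_two_pow_le hn2
  have hD := P.logDΔCK_le (2 ^ (n - 1)) hκ lev (lev + 1) 0
  obtain ⟨hlogκ, -⟩ := log_kappa_le P.hn
  have hlog3n : Real.log ((n : ℝ) + 2) ≤ (n : ℝ) + 1 := by
    have := Real.log_le_sub_one_of_pos (by positivity : (0 : ℝ) < n + 2); linarith only [this]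
  have hD' : Real.log (DΔC (P.YRK (2 ^ (n - 1)) lev) (P.Tf (lev + 1) 0)) ≤
      35 / 4 * P.Z / 64 + 35 / 4 * P.Z / 64 + 17 / 10 * (35 / 4 * (((n : ℝ) + 1) * XL) / 64) + 3 * (35 / 4 * (((n : ℝ) + 1) * XL) / 64) + 35 / 4 * XL / 64 := by
    have k1 : (P.Tf (lev + 1) 0 : ℝ) * Real.log (((2 ^ (n - 1) : ℕ) : ℝ) * n) ≤ (P.Tf (lev + 1) 0 : ℝ) * (17 / 10 * n) :=
      mul_le_mul_of_nonneg_left hlogκ hT'0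
    have k2 : (P.Tf (lev + 1) 0 : ℝ) * (17 / 10 * (n : ℝ)) ≤ 17 / 10 * ((P.Tf (lev + 1) 0 : ℝ) * ((n : ℝ) + 1)) := by
      have e2 : 17 / 10 * ((P.Tf (lev + 1) 0 : ℝ) * ((n : ℝ) + 1)) = (P.Tf (lev + 1) 0 : ℝ) * (17 / 10 * (n : ℝ)) + 17 / 10 * (P.Tf (lev + 1) 0 : ℝ) := by ring
      rw [e2]; linarith only [hT'0]
    have k3 : (P.Tf (lev + 1) 0 : ℝ) * Real.log ((n : ℝ) + 2) ≤ (P.Tf (lev + 1) 0 : ℝ) * ((n : ℝ) + 1) := mul_le_mul_of_nonneg_left hlog3n hT'0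
    have e : (P.Tf (lev + 1) 0 : ℝ) * (P.WN + Real.log P.N + Real.log (((2 ^ (n - 1) : ℕ) : ℝ) * n) + 3 * Real.log ((n : ℝ) + 2) + 1) =
        (P.Tf (lev + 1) 0 : ℝ) * P.WN + (P.Tf (lev + 1) 0 : ℝ) * Real.log P.N + (P.Tf (lev + 1) 0 : ℝ) * Real.log (((2 ^ (n - 1) : ℕ) : ℝ) * n) +
          3 * ((P.Tf (lev + 1) 0 : ℝ) * Real.log ((n : ℝ) + 2)) + (P.Tf (lev + 1) 0 : ℝ) := by ring
    linarith only [hD, e, k1, k2, k3, tW, tN, tn, t1]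
  have hWJ := P.logWC_half_le hn2 hlev (P.Tf lev n) hNf0 hρNf
  have hdeb := P.debris_le hn2
  -- the interpolation logarithm, the jets constant, the comparison letter
  have hlogJ := P.logJ_le hn2 hlev.le
  have hTC := P.TlogCRK_le hn2 hmono hlev.le
  have hcb := P.cbRK_le hn2 hlev.le c (P.Nf lev n) hNf1
  obtain ⟨hl2, hl3, -, -⟩ := log_consts
  have ha' : (a : ℝ) ≤ P.Tf (lev + 1) 0 := by exact_mod_cast ha.le
  have haL : (a : ℝ) * Real.log 2 ≤ 7 / 10 * (35 / 4 * XL / 64) := by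
    have := mul_le_mul ha' hl2 (Real.log_pos one_lt_two).le hT'0
    linarith only [this, t1]
  have hL16 : 8 * (P.L : ℝ) ≤ XL / 16 := by
    rw [hXL, le_div_iff₀ (by norm_num)]
    have := mul_le_mul_of_nonneg_right hX hL0.le
    linarith only [this]
  -- the bracket
  have hJ := P.jet_le hn2 hlev (by norm_num) hT' s a hsabs ha
  -- transfers
  have hC4 : 4 * (((n : ℝ) + 1) * XL) ≤ 2 ^ n * (((n : ℝ) + 1) * XL) := mul_le_mul_of_nonneg_right h2n (by positivity)
  have hD4 : 4 * XL ≤ 2 ^ n * XL := mul_le_mul_of_nonneg_right h2n hXL0.le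
  have hnB0 : 0 ≤ (n : ℝ) * (2 ^ n * XL) := by positivity
  have hB0 : 0 < 2 ^ n * XL := by positivity
  -- stage 1: the interpolation / jets / slab debris of the line
  have hO1 : Real.log (2 * ((2 * P.Nf lev n + 1 : ℕ) : ℝ) ^ (P.T lev + 1) * P.T lev * (20 * Real.exp 1) ^ ((2 * P.Nf lev n + 1) * P.T lev)) +
      P.T lev * Real.log (2 * P.CRK (2 ^ (n - 1)) lev) + P.γb lev * (P.Nf lev n + 1) + a * Real.log 2 + P.T lev +
      (P.γb lev + P.wl lev) * P.Nf lev n + Real.log 3 ≤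
      (336 / 5 * (2 ^ n * XL) + 19 * XL) + 8 * XL + (31 / 40 * n * (2 ^ n * XL) + 2 ^ n * XL / 2 ^ 16) + 7 / 10 * (35 / 4 * XL / 64) + XL / 16 +
      (31 / 40 * n * (2 ^ n * XL) + 2 ^ n * XL / 2 ^ 16 + 2 ^ n * XL / 2 ^ 16) + 7 / 5 := by
    linarith only [hlogJ, hTC, hγ1b, haL, hT8, hL16, hγwNf, hγ1, hwl3, hl3]
  -- stage 2: the letters of the line
  have hO2 : P.γb lev * (3 * P.Nf lev n + 2) + P.cUR + P.cPRK (2 ^ (n - 1)) + Real.log (DΔC (P.YRK (2 ^ (n - 1)) lev) (P.Tf (lev + 1) 0)) +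
      Real.log (WC P.H (P.Sd - (lev + 1) + 1) P.L₀ (P.Tf lev n) (P.Nf lev n)) + P.cbRK (2 ^ (n - 1)) c lev (P.Nf lev n) ≤
      (31 / 40 * n * (2 ^ n * XL) + 2 ^ n * XL / 2 ^ 16) + (P.Z / 392 + P.Z / 2 ^ 29) + 51 / 25 * P.Z +
      (35 / 4 * P.Z / 64 + 35 / 4 * P.Z / 64 + 17 / 10 * (35 / 4 * (((n : ℝ) + 1) * XL) / 64) + 3 * (35 / 4 * (((n : ℝ) + 1) * XL) / 64) + 35 / 4 * XL / 64) +
      (33 / 2 * (10 * (((n : ℝ) + 1) * XL) + 19 * XL) / 64 + 33 / 2 * P.Z / 64 + P.X / 8 + (22 / 100 * P.Z + (19 * n + 47 + Real.log P.N))) +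
      (XL / 2 ^ 16 - P.U0 c) := by
    linarith only [hγ1, hcU, hcP, hD', hWJ, tSn, hcb]
  rw [hZ] at hU16 hJ hO2
  linarith only [hO1, hO2, hJ, hdeb, hU16, hU, hC4, hD4, hnB0, hB0, hXL0]

/-- **the comparison line (C) of the half step** of `HalfStepLinesK (2^(n−1)) c lev` (comparison on the radius `3Nf+2` after the
threshold), for `n ≥ 2`, `lev < Ŝ`, `c ≥ 2^63`: strict, killed by `U0 c ≥ 128(nB+B)`. [cite: Nesterenko2003, §4.3 (4.50)–(4.51); shape only] -/
theorem halfC_holds (hn2 : 2 ≤ n) {lev : ℕ} (hlev : lev < P.Sd) {c : ℝ} (hc : (2 : ℝ) ^ 63 ≤ c)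
    (s : ℤ) (a : ℕ) (hsabs : |s| ≤ 2 * (P.Nh (lev + 1) : ℤ) - 1) (ha : a < P.Tf (lev + 1) 0) :
    P.cUR + P.cPRK (2 ^ (n - 1)) + Real.log (DΔC (P.YRK (2 ^ (n - 1)) lev) (P.Tf (lev + 1) 0)) +
      Real.log (WC P.H (P.Sd - (lev + 1) + 1) P.L₀ (P.Tf (lev + 1) 0) (P.Nh (lev + 1))) +
      (P.γb lev + P.wl lev) * (3 * P.Nf lev n + 2) + P.cbRK (2 ^ (n - 1)) c lev (3 * P.Nf lev n + 2) +
      (2 : ℝ) ^ n * (Real.log 4 + (23 / 20 * a * P.H + (|(s : ℝ)| * ∑ j, ((P.LνRR lev j : ℝ) / P.N) * P.A j + n * P.SAR + 2 * P.SAR)) +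
        (Real.log 2 + P.cUR + P.cPRK (2 ^ (n - 1)) + Real.log (DΔC (P.YRK (2 ^ (n - 1)) lev) (P.Tf (lev + 1) 0)) +
          (Real.log (WC P.H (P.Sd - (lev + 1) + 1) P.L₀ (P.Tf (lev + 1) 0) (P.Nh (lev + 1))) + (P.γb lev + P.wl lev) * P.Nh (lev + 1) +
            P.AθsumR / 2)) + 2 * P.cHR) +
      Real.log 3 < 0 := by
  have hκ : 1 ≤ 2 ^ (n - 1) := Nat.one_le_two_pow
  obtain ⟨-, -, hG, hL0, -, hT1, hT8⟩ := P.letters_real lev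
  have hX : (128 : ℝ) ≤ P.X := P.X_floors.2.1
  have hn : (2 : ℝ) ≤ n := by exact_mod_cast hn2
  have hn0 : (0 : ℝ) ≤ n := by linarith
  have h2n : (4 : ℝ) ≤ 2 ^ n :=
    calc (4 : ℝ) = 2 ^ 2 := by norm_num
      _ ≤ 2 ^ n := pow_le_pow_right₀ (by norm_num) hn2
  set XL : ℝ := (P.X : ℝ) * P.L with hXL
  have hXL0 : 0 < XL := by positivity
  have hZ : P.Z = 8 * ((n : ℝ) + 1) * XL := by unfold Z; rw [hG]
  obtain ⟨hT', hT'0⟩ := P.Tsucc_le hn2 hlev hT8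
  obtain ⟨-, tn, t1, tW, tN, tS, -⟩ := P.Tcost_le hT'0 (by norm_num) hT'
  obtain ⟨hU16, hU⟩ := P.U0_big hn2 hc
  obtain ⟨hρNh, -, -, -, hNf0, hNh0⟩ := P.rho_bounds lev
  obtain ⟨h3Nf1, -, -⟩ := P.rho_succ_bounds lev
  obtain ⟨hγ1, -, hwl3, -, -⟩ := P.gamma_le lev
  obtain ⟨hcU, -⟩ := P.cUR_le' hn2
  have hcP := P.cPRK_two_pow_le hn2
  have hD := P.logDΔCK_le (2 ^ (n - 1)) hκ lev (lev + 1) 0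
  obtain ⟨hlogκ, -⟩ := log_kappa_le P.hn
  have hlog3n : Real.log ((n : ℝ) + 2) ≤ (n : ℝ) + 1 := by
    have := Real.log_le_sub_one_of_pos (by positivity : (0 : ℝ) < n + 2); linarith only [this]
  have hD' : Real.log (DΔC (P.YRK (2 ^ (n - 1)) lev) (P.Tf (lev + 1) 0)) ≤
      35 / 4 * P.Z / 64 + 35 / 4 * P.Z / 64 + 17 / 10 * (35 / 4 * (((n : ℝ) + 1) * XL) / 64) + 3 * (35 / 4 * (((n : ℝ) + 1) * XL) / 64) + 35 / 4 * XL / 64 := by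
    have k1 : (P.Tf (lev + 1) 0 : ℝ) * Real.log (((2 ^ (n - 1) : ℕ) : ℝ) * n) ≤ (P.Tf (lev + 1) 0 : ℝ) * (17 / 10 * n) :=
      mul_le_mul_of_nonneg_left hlogκ hT'0
    have k2 : (P.Tf (lev + 1) 0 : ℝ) * (17 / 10 * (n : ℝ)) ≤ 17 / 10 * ((P.Tf (lev + 1) 0 : ℝ) * ((n : ℝ) + 1)) := by
      have e2 : 17 / 10 * ((P.Tf (lev + 1) 0 : ℝ) * ((n : ℝ) + 1)) = (P.Tf (lev + 1) 0 : ℝ) * (17 / 10 * (n : ℝ)) + 17 / 10 * (P.Tf (lev + 1) 0 : ℝ) := by ring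
      rw [e2]; linarith only [hT'0]
    have k3 : (P.Tf (lev + 1) 0 : ℝ) * Real.log ((n : ℝ) + 2) ≤ (P.Tf (lev + 1) 0 : ℝ) * ((n : ℝ) + 1) := mul_le_mul_of_nonneg_left hlog3n hT'0
    have e : (P.Tf (lev + 1) 0 : ℝ) * (P.WN + Real.log P.N + Real.log (((2 ^ (n - 1) : ℕ) : ℝ) * n) + 3 * Real.log ((n : ℝ) + 2) + 1) =
        (P.Tf (lev + 1) 0 : ℝ) * P.WN + (P.Tf (lev + 1) 0 : ℝ) * Real.log P.N + (P.Tf (lev + 1) 0 : ℝ) * Real.log (((2 ^ (n - 1) : ℕ) : ℝ) * n) +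
          3 * ((P.Tf (lev + 1) 0 : ℝ) * Real.log ((n : ℝ) + 2)) + (P.Tf (lev + 1) 0 : ℝ) := by ring
    linarith only [hD, e, k1, k2, k3, tW, tN, tn, t1]
  have hWh := P.logWC_half_le hn2 hlev (P.Tf (lev + 1) 0) hNh0 hρNh
  have hdeb := P.debris_le hn2
  have hcb := P.cbRK_le hn2 hlev.le c (3 * P.Nf lev n + 2) (by push_cast; linarith)
  have hcb' : P.cbRK (2 ^ (n - 1)) c lev (3 * P.Nf lev n + 2) ≤ XL / 2 ^ 16 - P.U0 c := hcb
  obtain ⟨-, hl3, -, -⟩ := log_consts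
  have hγw : (P.γb lev + P.wl lev) * (3 * (P.Nf lev n : ℝ) + 2) = P.γb lev * (3 * (P.Nf lev n : ℝ) + 2) + P.wl lev * (3 * (P.Nf lev n : ℝ) + 2) := by
    ring
  have hJ := P.jet_le hn2 hlev (by norm_num) hT' s a hsabs ha
  have hC4 : 4 * (((n : ℝ) + 1) * XL) ≤ 2 ^ n * (((n : ℝ) + 1) * XL) := mul_le_mul_of_nonneg_right h2n (by positivity)
  have hD4 : 4 * XL ≤ 2 ^ n * XL := mul_le_mul_of_nonneg_right h2n hXL0.le
  have hnB0 : 0 ≤ (n : ℝ) * (2 ^ n * XL) := by positivity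
  have hB0 : 0 < 2 ^ n * XL := by positivity
  have hO2 : P.cUR + P.cPRK (2 ^ (n - 1)) + Real.log (DΔC (P.YRK (2 ^ (n - 1)) lev) (P.Tf (lev + 1) 0)) +
      Real.log (WC P.H (P.Sd - (lev + 1) + 1) P.L₀ (P.Tf (lev + 1) 0) (P.Nh (lev + 1))) +
      (P.γb lev + P.wl lev) * (3 * P.Nf lev n + 2) + P.cbRK (2 ^ (n - 1)) c lev (3 * P.Nf lev n + 2) + Real.log 3 ≤
      (P.Z / 392 + P.Z / 2 ^ 29) + 51 / 25 * P.Z +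
      (35 / 4 * P.Z / 64 + 35 / 4 * P.Z / 64 + 17 / 10 * (35 / 4 * (((n : ℝ) + 1) * XL) / 64) + 3 * (35 / 4 * (((n : ℝ) + 1) * XL) / 64) + 35 / 4 * XL / 64) +
      (35 / 4 * (10 * (((n : ℝ) + 1) * XL) + 19 * XL) / 64 + 35 / 4 * P.Z / 64 + P.X / 8 + (22 / 100 * P.Z + (19 * n + 47 + Real.log P.N))) +
      (31 / 40 * n * (2 ^ n * XL) + 2 ^ n * XL / 2 ^ 16 + 2 ^ n * XL / 2 ^ 16) + (XL / 2 ^ 16 - P.U0 c) + 7 / 5 := by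
    linarith only [hcU, hcP, hD', hWh, tS, hγw, hγ1, hwl3, hcb', hl3]
  rw [hZ] at hU16 hJ hO2
  linarith only [hO2, hJ, hdeb, hU16, hU, hC4, hD4, hnB0, hB0, hXL0]

/-! ### The family -/

/-- **THE HALF-STEP FAMILY OF THE CLOSED LETTER LINES**: for `n ≥ 2`, sorted weights, `lev < Ŝ` and `c ≥ 2^63`,
`HalfStepLinesK (2^(n−1)) c lev` — side conditions (p1's `side_half`), smallness, (J), (F), (C).
[cite: Nesterenko2003, §4 Prop. 4.1, §4.3; shape only] -/
theorem halfStepLinesK_holds (hn2 : 2 ≤ n) (hmono : Monotone P.A) {lev : ℕ} (hlev : lev < P.Sd) {c : ℝ} (hc : (2 : ℝ) ^ 63 ≤ c) :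
    P.HalfStepLinesK (2 ^ (n - 1)) c lev := by
  obtain ⟨h1, h2, h3⟩ := P.side_half lev hlev
  unfold HalfStepLinesK
  exact ⟨h1, h2, h3, P.halfSmall_holds hn2 hlev hc, fun s a _ hsa ha => P.halfJ_holds hn2 hmono hlev hc s a hsa ha,
    fun s a _ hsa ha => P.halfF_holds hn2 hlev hc s a hsa ha, fun s a _ hsa ha => P.halfC_holds hn2 hlev hc s a hsa ha⟩

end ArchG3Rec

end Summit.ABC.StewartYu

end
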